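import Summits.KontsevichZagierPeriods.KontsevichZagierPeriods.Theorems.SymplecticScissorsPlanarCompilerGreenAux1
import Literature.NumberTheory.Transcendental.SemialgebraicMapsProofs
import Literature.NumberTheory.Transcendental.KZSemiCanonicalReductionProofs

/-!
# `PlanarCompiler` (stmt-KontsevichZagierPeriods-10058), line `twist-restoring-shear` — Green bookkeeping III

Helper file for the lead's stub `stub_greenAssembly` (crux protocol, `--supports`): the COMMON
REFINEMENT of two signed almost-partitions.

`sum_smul_of_sub_sum_smul_of_mem_planarGroup`: let `Ψ` be a `ℚ`-semialgebraic map on a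
`ℚ`-semialgebraic planar set `U`, and let `(C i, ε i)` and `(D k, ε' k)` be two finite families of
pairwise disjoint `ℚ`-semialgebraic pieces of `U`, each covering `U` up to a null set, with signs in
`ℤ` that agree wherever two pieces meet, `Ψ` differentiable and injective on every piece of non-zero
sign. If `r i`, `r' k` are integrand-`1` representations on `Ψ '' C i`, `Ψ '' D k`, then
`∑ ε i • [r i] ≡ ∑ ε' k • [r' k]` in the planar set-chain group: both sides are redistributed by
rule 1a onto the pieces `Ψ '' (C i ∩ D k)` (images of null sets under differentiable maps are null,
`MeasureTheory.addHaar_image_eq_zero_of_differentiableOn_of_addHaar_eq_zero`).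

No new definitions. [Kontsevich–Zagier 2001, §1.2; folklore]
-/

noncomputable section

open MeasureTheory Set
open Literature.NumberTheory.Transcendental Literature.ModelTheory.ExponentialFields
open Summit.KontsevichZagierPeriods.SymplecticScissors.PlanarK0InjectiveNegative

namespace Summit.KontsevichZagierPeriods.SymplecticScissors.PlanarCompilerProof

/-- The domain of an integrand-`1` representation has finite volume. [folklore] -/
theorem volume_domain_lt_top_of_integrand_one {n : ℕ} (r : KZ.IntegralRep n)
    (hr : ∀ q ∈ r.domain, r.integrand q = 1) : volume r.domain < ⊤ := by
  have h1 : IntegrableOn (fun _ => (1 : ℝ)) r.domain :=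
    r.integrableOn.congr_fun (fun q hq => hr q hq) (KZ.IntegralRep.measurableSet_domain_holds r)
  have := (integrableOn_const_iff (C := (1 : ℝ)) (s := r.domain) (μ := volume)).mp h1
  simpa using this

/-- A `ℤ`-multiple of an element of `planarGroup` lies in `planarGroup`. [folklore] -/
theorem zsmul_mem_planarGroup {x : KZ.FormalRep} (hx : x ∈ planarGroup) (z : ℤ) :
    z • x ∈ planarGroup :=
  AddSubgroup.zsmul_mem _ hx z

/-- **Common refinement of two signed almost-partitions.** See the module docstring. [folklore] -/
theorem sum_smul_of_sub_sum_smul_of_mem_planarGroup {Ψ : (Fin 2 → ℝ) → (Fin 2 → ℝ)}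
    {U : Set (Fin 2 → ℝ)} (hΨ : IsSemialgebraicMapOn ℚ U Ψ) {m m' : ℕ}
    (C : Fin m → Set (Fin 2 → ℝ)) (D : Fin m' → Set (Fin 2 → ℝ)) (ε : Fin m → ℤ) (ε' : Fin m' → ℤ)
    (hCs : ∀ i, IsSemialgebraic ℚ (C i)) (hCU : ∀ i, C i ⊆ U)
    (hCd : Pairwise fun i j => Disjoint (C i) (C j)) (hCcov : volume (U \ ⋃ i, C i) = 0)
    (hDs : ∀ k, IsSemialgebraic ℚ (D k)) (hDU : ∀ k, D k ⊆ U)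
    (hDd : Pairwise fun k l => Disjoint (D k) (D l)) (hDcov : volume (U \ ⋃ k, D k) = 0)
    (hΨC : ∀ i, ε i ≠ 0 → DifferentiableOn ℝ Ψ (C i) ∧ InjOn Ψ (C i))
    (hΨD : ∀ k, ε' k ≠ 0 → DifferentiableOn ℝ Ψ (D k) ∧ InjOn Ψ (D k))
    (hsign : ∀ i k, (C i ∩ D k).Nonempty → ε i = ε' k)
    (r : Fin m → KZ.IntegralRep 2) (r' : Fin m' → KZ.IntegralRep 2)
    (hrd : ∀ i, (r i).domain = Ψ '' C i) (hr1 : ∀ i, ∀ q ∈ (r i).domain, (r i).integrand q = 1)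
    (hr'd : ∀ k, (r' k).domain = Ψ '' D k) (hr'1 : ∀ k, ∀ q ∈ (r' k).domain, (r' k).integrand q = 1) :
    ∑ i, ε i • KZ.of (r i) - ∑ k, ε' k • KZ.of (r' k) ∈ planarGroup := by
  classical
  -- the pieces and integrand-1 representations on them
  have hPs : ∀ i k, IsSemialgebraic ℚ (Ψ '' (C i ∩ D k)) := fun i k =>
    IsSemialgebraicMapOn.isSemialgebraic_image_holds hΨ
      (fun p hp => hCU i hp.1) ((hCs i).inter (hDs k))
  have hPfin : ∀ i k, volume (Ψ '' (C i ∩ D k)) ≠ ⊤ := fun i k => by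
    refine (lt_of_le_of_lt (measure_mono ?_)
      (volume_domain_lt_top_of_integrand_one (r i) (hr1 i))).ne
    rw [hrd i]; exact image_mono inter_subset_left
  choose e hed hei using fun (ik : Fin m × Fin m') => KZ.exists_oneRep (hPs ik.1 ik.2) (hPfin ik.1 ik.2)
  have he1 : ∀ i k, ∀ q ∈ (e (i, k)).domain, (e (i, k)).integrand q = 1 := fun i k q _ => by
    rw [hei (i, k)]
  -- images of the null leftovers are null
  have hnullC : ∀ i, ε i ≠ 0 → volume (Ψ '' C i \ ⋃ k ∈ (Finset.univ : Finset (Fin m')),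
      Ψ '' (C i ∩ D k)) = 0 := by
    intro i hi
    have hsub : Ψ '' C i \ ⋃ k ∈ (Finset.univ : Finset (Fin m')), Ψ '' (C i ∩ D k) ⊆
        Ψ '' (C i ∩ (U \ ⋃ k, D k)) := by
      rintro q ⟨⟨p, hp, rfl⟩, hq⟩
      refine ⟨p, ⟨hp, hCU i hp, fun hpD => hq ?_⟩, rfl⟩
      obtain ⟨k, hk⟩ := mem_iUnion.mp hpD
      exact mem_iUnion₂.mpr ⟨k, Finset.mem_univ k, ⟨p, ⟨hp, hk⟩, rfl⟩⟩
    exact measure_mono_null hsub (addHaar_image_eq_zero_of_differentiableOn_of_addHaar_eq_zero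
      (μ := volume) ((hΨC i hi).1.mono inter_subset_left)
      (measure_mono_null inter_subset_right hDcov))
  have hnullD : ∀ k, ε' k ≠ 0 → volume (Ψ '' D k \ ⋃ i ∈ (Finset.univ : Finset (Fin m)),
      Ψ '' (C i ∩ D k)) = 0 := by
    intro k hk
    have hsub : Ψ '' D k \ ⋃ i ∈ (Finset.univ : Finset (Fin m)), Ψ '' (C i ∩ D k) ⊆
        Ψ '' (D k ∩ (U \ ⋃ i, C i)) := by
      rintro q ⟨⟨p, hp, rfl⟩, hq⟩
      refine ⟨p, ⟨hp, hDU k hp, fun hpC => hq ?_⟩, rfl⟩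
      obtain ⟨i, hi⟩ := mem_iUnion.mp hpC
      exact mem_iUnion₂.mpr ⟨i, Finset.mem_univ i, ⟨p, ⟨hi, hp⟩, rfl⟩⟩
    exact measure_mono_null hsub (addHaar_image_eq_zero_of_differentiableOn_of_addHaar_eq_zero
      (μ := volume) ((hΨD k hk).1.mono inter_subset_left)
      (measure_mono_null inter_subset_right hCcov))
  -- rule 1a redistribution of each `r i` and each `r' k`
  have hri : ∀ i, ε i ≠ 0 → KZ.of (r i) - ∑ k, KZ.of (e (i, k)) ∈ planarGroup := by
    intro i hi
    refine of_sub_sum_mem_planarGroup Finset.univ (r i) (hr1 i) (fun k => Ψ '' (C i ∩ D k))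
      (fun k => e (i, k)) (fun k _ => hPs i k) (fun k _ => ?_) (fun k _ l _ hkl => ?_)
      (by rw [hrd i]; exact hnullC i hi) (fun k _ => hed (i, k)) (fun k _ => he1 i k)
    · rw [hrd i]; exact image_mono inter_subset_left
    · refine disjoint_image_image fun p hp q hq hpq => hkl ?_
      have : p = q := (hΨC i hi).2 hp.1 hq.1 hpq
      subst this
      by_contra hne
      exact Set.disjoint_left.mp (hDd hne) hp.2 hq.2
  have hrk : ∀ k, ε' k ≠ 0 → KZ.of (r' k) - ∑ i, KZ.of (e (i, k)) ∈ planarGroup := by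
    intro k hk
    refine of_sub_sum_mem_planarGroup Finset.univ (r' k) (hr'1 k) (fun i => Ψ '' (C i ∩ D k))
      (fun i => e (i, k)) (fun i _ => hPs i k) (fun i _ => ?_) (fun i _ j _ hij => ?_)
      (by rw [hr'd k]; exact hnullD k hk) (fun i _ => hed (i, k)) (fun i _ => he1 i k)
    · rw [hr'd k]; exact image_mono inter_subset_right
    · refine disjoint_image_image fun p hp q hq hpq => hij ?_
      have : p = q := (hΨD k hk).2 hp.2 hq.2 hpq
      subst this
      by_contra hne
      exact Set.disjoint_left.mp (hCd hne) hp.1 hq.1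
  -- signed sums
  have h1 : ∑ i, ε i • KZ.of (r i) - ∑ i, ∑ k, ε i • KZ.of (e (i, k)) ∈ planarGroup := by
    rw [← Finset.sum_sub_distrib]
    refine sum_mem fun i _ => ?_
    by_cases hi : ε i = 0
    · simp [hi]
    · rw [← Finset.smul_sum, ← smul_sub]
      exact zsmul_mem_planarGroup (hri i hi) _
  have h2 : ∑ k, ε' k • KZ.of (r' k) - ∑ k, ∑ i, ε' k • KZ.of (e (i, k)) ∈ planarGroup := by
    rw [← Finset.sum_sub_distrib]
    refine sum_mem fun k _ => ?_
    by_cases hk : ε' k = 0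
    · simp [hk]
    · rw [← Finset.smul_sum, ← smul_sub]
      exact zsmul_mem_planarGroup (hrk k hk) _
  have h3 : ∑ i, ∑ k, ε i • KZ.of (e (i, k)) - ∑ k, ∑ i, ε' k • KZ.of (e (i, k)) ∈ planarGroup := by
    rw [Finset.sum_comm (f := fun k i => ε' k • KZ.of (e (i, k))), ← Finset.sum_sub_distrib]
    refine sum_mem fun i _ => ?_
    rw [← Finset.sum_sub_distrib]
    refine sum_mem fun k _ => ?_
    by_cases hne : (C i ∩ D k).Nonempty
    · rw [hsign i k hne, sub_self]; exact zero_mem _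
    · have h0 : volume (e (i, k)).domain = 0 := by
        rw [hed (i, k), not_nonempty_iff_eq_empty.mp hne, image_empty, measure_empty]
      rw [← sub_smul]
      exact zsmul_mem_planarGroup (of_mem_planarGroup_of_volume_eq_zero _ (he1 i k) h0) _
  have hsplit : ∑ i, ε i • KZ.of (r i) - ∑ k, ε' k • KZ.of (r' k) =
      (∑ i, ε i • KZ.of (r i) - ∑ i, ∑ k, ε i • KZ.of (e (i, k))) +
        (∑ i, ∑ k, ε i • KZ.of (e (i, k)) - ∑ k, ∑ i, ε' k • KZ.of (e (i, k))) -
        (∑ k, ε' k • KZ.of (r' k) - ∑ k, ∑ i, ε' k • KZ.of (e (i, k))) := by abel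
  rw [hsplit]
  exact sub_mem (add_mem h1 h3) h2

/-- Registered anchor of this helper file (crux protocol `--supports`): the common refinement (`sum_smul_of_sub_sum_smul_of_mem_planarGroup`). [folklore] -/
theorem stub_greenAux3 :
    ∀ (Ψ : (Fin 2 → ℝ) → (Fin 2 → ℝ)) (U : Set (Fin 2 → ℝ)), IsSemialgebraicMapOn ℚ U Ψ → ∀ (m m' : ℕ) (C : Fin m → Set (Fin 2 → ℝ)) (D : Fin m' → Set (Fin 2 → ℝ)) (ε : Fin m → ℤ) (ε' : Fin m' → ℤ), (∀ i, IsSemialgebraic ℚ (C i)) → (∀ i, C i ⊆ U) → (Pairwise fun i j => Disjoint (C i) (C j)) → MeasureTheory.volume (U \ ⋃ i, C i) = 0 → (∀ k, IsSemialgebraic ℚ (D k)) → (∀ k, D k ⊆ U) → (Pairwise fun k l => Disjoint (D k) (D l)) → MeasureTheory.volume (U \ ⋃ k, D k) = 0 → (∀ i, ε i ≠ 0 → DifferentiableOn ℝ Ψ (C i) ∧ Set.InjOn Ψ (C i)) → (∀ k, ε' k ≠ 0 → DifferentiableOn ℝ Ψ (D k) ∧ Set.InjOn Ψ (D k)) →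 (∀ i k, (C i ∩ D k).Nonempty → ε i = ε' k) → ∀ (r : Fin m → KZ.IntegralRep 2) (r' : Fin m' → KZ.IntegralRep 2), (∀ i, (r i).domain = Ψ '' C i) → (∀ i, ∀ q ∈ (r i).domain, (r i).integrand q = 1) → (∀ k, (r' k).domain = Ψ '' D k) → (∀ k, ∀ q ∈ (r' k).domain, (r' k).integrand q = 1) → ∑ i, ε i • KZ.of (r i) - ∑ k, ε' k • KZ.of (r' k) ∈ AddSubgroup.closure ((KZ.domainAddRel ∪ KZ.changeOfVariablesRel) ∩ (AddSubgroup.closure {x : KZ.FormalRep | ∃ s : KZ.IntegralRep 2, (∀ p ∈ s.domain, s.integrand p = 1) ∧ x = KZ.of s} : Set KZ.FormalRep)) :=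
  fun _ _ hΨ _ _ C D ε ε' a b c d e f g h i j k r r' l m n o =>
    sum_smul_of_sub_sum_smul_of_mem_planarGroup hΨ C D ε ε' a b c d e f g h i j k r r' l m n o

end Summit.KontsevichZagierPeriods.SymplecticScissors.PlanarCompilerProof
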